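import Mathlib
import Summits.Ventures.HodgeRepro.Tier4.Line1.RTFSetting
import Summits.Ventures.HodgeRepro.Tier4.Common.L1Convolution

/-!
# Tier4/Line4/LatticeCount — the uniform lattice count `#(G(k) ∩ gK) ≤ n` and the Poincaré bound for `L¹ ⋆ C_c`

Blind re-derivation cell `pub-hodge-repro`, Tier 4 «prove the step» (README §9–§10), seat t4-L4-p2 (prover, LINE L4,
gen 4; self-cut C-L4-LATTICECOUNT, S14817, on t4-crit-1's objection S14790 to the §15 display (1)/(1′) of
`work/v33/L1Class-STATEMENTS.lean`).  Tree path `lean/Summits/Ventures/HodgeRepro/Tier4/Line4/LatticeCount.lean`.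
Mathlib-level; no literature; no `def`.

THE MATHEMATICS.  `Γ = S.Gk` is a discrete subgroup of the topological group `G` (`S.discrete`; closedness is not
used here).
* `exists_isOpen_isolating_one`: an open `U ∋ 1` with `Γ ∩ U = {1}` (the subtype topology of `Γ` is induced).
* `exists_card_le_of_isCompact` — **the uniform lattice count**: for a compact `K ⊆ G` there is `n` with
  `#(Γ ∩ gK) ≤ n` for EVERY `g ∈ G`.  Take `V` open, `1 ∈ V`, `V * V ⊆ U`, and the symmetric `W := V ∩ V⁻¹`; cover
  `K ⊆ ⋃_{k ∈ t} k W` by finitely many translates; two rational points `γ = g k w`, `γ′ = g k w′` in the same `g k W`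
  have `γ⁻¹ γ′ = w⁻¹ w′ ∈ W⁻¹ W ⊆ V V ⊆ U`, hence `γ = γ′`; so `#(Γ ∩ gK) ≤ #t`.  This is the ONE-SIDED count of
  S14790 («bounded uniformly in `g` by discreteness alone»); the two-sided count `#(Γ ∩ C₁ h K C₂⁻¹)` is NOT bounded
  in `h` and is not claimed.
* `exists_card_le_of_isCompact_right`: the same with a compact `C₂` on the right (`K * C₂⁻¹` is compact);
  `exists_sum_norm_le_of_isTest`: for a test function `f` (continuous, compact support) the sums
  `∑_{γ ∈ F} ‖f (g⁻¹ γ y)‖` over finite `F` are bounded by `n · sup ‖f‖` uniformly in `g ∈ G`, `y ∈ C₂`.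
* `exists_summable_norm_conv_of_isTestL1` — **the Poincaré bound for `f₁ ⋆ f₂`, `f₁ ∈ L¹`, `f₂ ∈ C_c`**: uniformly in
  `x ∈ G` and `y` in a compact `C₂`, the family `γ ↦ ‖(f₁ ⋆ f₂)(x⁻¹ γ y)‖` is summable with sum `≤ ‖f₁‖₁ · M`: for every
  finite `F`, `∑_{γ ∈ F} ‖(f₁ ⋆ f₂)(x⁻¹ γ y)‖ ≤ ∫ ‖f₁(h)‖ ∑_{γ ∈ F} ‖f₂(h⁻¹ x⁻¹ γ y)‖ dh ≤ ‖f₁‖₁ · M` (the inner sum is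
  the count at the one-sided translate `g = x h`), then `summable_of_sum_le` / `Real.tsum_le_of_sum_le`.  No countability
  of `Γ` and no Tonelli are needed (finite sums commute with the integral).
* `poincareUniform_conv_of_isTestL1`: the (α)-form display of S14790 verbatim as a theorem — for compact `C₁, C₂` one
  bound `M` for all `x ∈ C₁`, `y ∈ C₂`; `summable_norm_conv_of_isTestL1`: the kernel `K_{f₁ ⋆ f₂}(x, y)` converges
  absolutely at every point.

Nothing here says anything about the status of the Hodge conjecture for CM abelian varieties, which is NOT proved
(HC_CM is NOT proved by anyone in this repository).
-/

set_option autoImplicit false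

noncomputable section

namespace Summit.Ventures.HodgeRepro.Tier4.Line4

open MeasureTheory Topology Filter Summit.Ventures.HodgeRepro.Tier4 Summit.Ventures.HodgeRepro.Tier4.Line1
  Summit.Ventures.HodgeRepro.Tier4.Line1.RTF

open scoped Pointwise

variable {G : Type} [Group G] [TopologicalSpace G] [IsTopologicalGroup G] [MeasurableSpace G] [BorelSpace G]
  (S : Setting G)

/-! ## 1. The uniform lattice count -/

omit [IsTopologicalGroup G] [BorelSpace G] in
/-- **An isolating neighbourhood of `1`**: an open `U ∋ 1` of `G` meeting the discrete subgroup `G(k)` in `{1}` only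
(the topology of `S.Gk` is the induced one, and `{1}` is open in it by `S.discrete`). -/
theorem exists_isOpen_isolating_one :
    ∃ U : Set G, IsOpen U ∧ (1 : G) ∈ U ∧ ∀ γ : S.Gk, (γ : G) ∈ U → γ = 1 := by
  haveI : DiscreteTopology S.Gk := S.discrete
  obtain ⟨U, hUo, hU⟩ := isOpen_induced_iff.mp (isOpen_discrete ({1} : Set S.Gk))
  refine ⟨U, hUo, ?_, ?_⟩
  · have h1 : (1 : S.Gk) ∈ (Subtype.val ⁻¹' U : Set S.Gk) := by
      rw [hU]
      exact Set.mem_singleton _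
    exact h1
  · intro γ hγ
    have hmem : γ ∈ (Subtype.val ⁻¹' U : Set S.Gk) := hγ
    rw [hU] at hmem
    exact hmem

omit [BorelSpace G] in
/-- **The uniform lattice count**: for a compact `K ⊆ G` there is `n` such that every left translate `g K` contains at
most `n` rational points — `#(G(k) ∩ g K) ≤ n` for EVERY `g ∈ G`, by discreteness of `G(k)` alone.  Stated on finite
sets of rational points: any finite `F ⊆ G(k)` with `g⁻¹ γ ∈ K` for all `γ ∈ F` has `#F ≤ n`. -/
theorem exists_card_le_of_isCompact {K : Set G} (hK : IsCompact K) :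
    ∃ n : ℕ, ∀ g : G, ∀ F : Finset S.Gk, (∀ γ ∈ F, g⁻¹ * (γ : G) ∈ K) → F.card ≤ n := by
  classical
  obtain ⟨U, hUo, hU1, hU⟩ := exists_isOpen_isolating_one S
  obtain ⟨V, hVo, hV1, hVV⟩ := exists_open_nhds_one_mul_subset (hUo.mem_nhds hU1)
  -- the symmetric open neighbourhood `W = V ∩ V⁻¹` of `1`
  have hWo : IsOpen (V ∩ V⁻¹) := hVo.inter hVo.inv
  have hW1 : (1 : G) ∈ V ∩ V⁻¹ := ⟨hV1, by simpa using hV1⟩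
  have hWU : ∀ v ∈ V ∩ V⁻¹, ∀ w ∈ V ∩ V⁻¹, v⁻¹ * w ∈ U := fun v hv w hw =>
    hVV (Set.mul_mem_mul (Set.mem_inv.mp hv.2) hw.1)
  -- finitely many translates `k W`, `k ∈ t`, cover `K`
  obtain ⟨t, -, ht⟩ := hK.elim_nhds_subcover (fun k : G => {z : G | k⁻¹ * z ∈ V ∩ V⁻¹}) fun k _ => by
    refine (hWo.preimage (continuous_const.mul continuous_id)).mem_nhds ?_
    show k⁻¹ * k ∈ V ∩ V⁻¹
    simpa using hW1
  refine ⟨t.card, fun g F hF => ?_⟩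
  -- every rational point of `F` lies in some `g k W`, `k ∈ t`
  have hsel : ∀ γ ∈ F, ∃ k ∈ t, k⁻¹ * (g⁻¹ * (γ : G)) ∈ V ∩ V⁻¹ := by
    intro γ hγ
    have hmem := ht (hF γ hγ)
    rw [Set.mem_iUnion₂] at hmem
    obtain ⟨k, hk, hkγ⟩ := hmem
    exact ⟨k, hk, hkγ⟩
  choose! φ hφt hφW using hsel
  -- `γ ↦ k` is injective on `F`: two rational points of one `g k W` coincide
  refine Finset.card_le_card_of_injOn φ (fun γ hγ => hφt γ hγ) ?_
  intro γ hγ γ' hγ' hφ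
  have hw := hφW γ hγ
  have hw' := hφW γ' hγ'
  rw [hφ] at hw
  have hU' := hWU _ hw _ hw'
  have h1 : ((γ⁻¹ * γ' : S.Gk) : G) ∈ U := by
    convert hU' using 1
    simp only [Subgroup.coe_mul, Subgroup.coe_inv]
    group
  exact inv_mul_eq_one.mp (hU _ h1)

omit [BorelSpace G] in
/-- The set form of the uniform lattice count: `{γ ∈ G(k) | g⁻¹ γ ∈ K}` is finite with at most `n` elements, for every
`g ∈ G`. -/
theorem exists_ncard_le_of_isCompact {K : Set G} (hK : IsCompact K) :
    ∃ n : ℕ, ∀ g : G, {γ : S.Gk | g⁻¹ * (γ : G) ∈ K}.Finite ∧ {γ : S.Gk | g⁻¹ * (γ : G) ∈ K}.ncard ≤ n := by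
  classical
  obtain ⟨n, hn⟩ := exists_card_le_of_isCompact S hK
  refine ⟨n, fun g => ?_⟩
  have hfin : {γ : S.Gk | g⁻¹ * (γ : G) ∈ K}.Finite := by
    by_contra hinf
    obtain ⟨F, hFsub, hFcard⟩ := (Set.not_finite.mp hinf).exists_subset_card_eq (n + 1)
    have := hn g F fun γ hγ => hFsub hγ
    omega
  refine ⟨hfin, ?_⟩
  rw [Set.ncard_eq_toFinset_card _ hfin]
  exact hn g _ fun γ hγ => (hfin.mem_toFinset.mp hγ)

omit [BorelSpace G] in
/-- The uniform lattice count with a compact set `C₂` on the right: `#{γ ∈ G(k) | g⁻¹ γ y ∈ K} ≤ n` for every `g ∈ G`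
and every `y ∈ C₂` (such a `γ` has `g⁻¹ γ ∈ K · C₂⁻¹`, a compact set). -/
theorem exists_card_le_of_isCompact_right {K C₂ : Set G} (hK : IsCompact K) (hC₂ : IsCompact C₂) :
    ∃ n : ℕ, ∀ g : G, ∀ y ∈ C₂, ∀ F : Finset S.Gk, (∀ γ ∈ F, g⁻¹ * (γ : G) * y ∈ K) → F.card ≤ n := by
  obtain ⟨n, hn⟩ := exists_card_le_of_isCompact S (hK.mul hC₂.inv)
  refine ⟨n, fun g y hy F hF => hn g F fun γ hγ => ?_⟩
  have heq : g⁻¹ * (γ : G) = (g⁻¹ * γ * y) * y⁻¹ := by group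
  rw [heq]
  exact Set.mul_mem_mul (hF γ hγ) (Set.inv_mem_inv.mpr hy)

omit [BorelSpace G] in
/-- **Bounded lattice sums of a test function**: for `f` continuous with compact support and a compact `C₂`, the finite
sums `∑_{γ ∈ F} ‖f (g⁻¹ γ y)‖` are bounded by one constant `M = n · sup ‖f‖`, uniformly in `g ∈ G`, `y ∈ C₂` and the
finite set `F` of rational points (at most `n` terms are non-zero: `g⁻¹ γ y ∈ tsupport f`). -/
theorem exists_sum_norm_le_of_isTest {f : G → ℂ} (hf : IsTest f) {C₂ : Set G} (hC₂ : IsCompact C₂) :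
    ∃ M : ℝ, 0 ≤ M ∧ ∀ g : G, ∀ y ∈ C₂, ∀ F : Finset S.Gk, ∑ γ ∈ F, ‖f (g⁻¹ * (γ : G) * y)‖ ≤ M := by
  classical
  obtain ⟨B, hB⟩ : ∃ B : ℝ, ∀ z, ‖f z‖ ≤ B := by
    obtain ⟨B, hB⟩ := hf.cont.norm.bddAbove_range_of_hasCompactSupport hf.compact.norm
    exact ⟨B, fun z => hB ⟨z, rfl⟩⟩
  have hB0 : 0 ≤ B := le_trans (norm_nonneg _) (hB 1)
  obtain ⟨n, hn⟩ := exists_card_le_of_isCompact_right S hf.compact.isCompact hC₂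
  refine ⟨n * B, by positivity, fun g y hy F => ?_⟩
  rw [← Finset.sum_filter_ne_zero]
  calc ∑ γ ∈ F.filter (fun γ : S.Gk => ‖f (g⁻¹ * (γ : G) * y)‖ ≠ 0), ‖f (g⁻¹ * (γ : G) * y)‖
      ≤ (F.filter (fun γ : S.Gk => ‖f (g⁻¹ * (γ : G) * y)‖ ≠ 0)).card • B :=
        Finset.sum_le_card_nsmul _ _ _ fun γ _ => hB _
    _ = ((F.filter (fun γ : S.Gk => ‖f (g⁻¹ * (γ : G) * y)‖ ≠ 0)).card : ℝ) * B := by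
        rw [nsmul_eq_mul]
    _ ≤ n * B := by
        apply mul_le_mul_of_nonneg_right _ hB0
        exact_mod_cast hn g y hy _ fun γ hγ => by
          rw [Finset.mem_filter] at hγ
          exact subset_tsupport f fun h0 => hγ.2 (by rw [h0, norm_zero])

/-! ## 2. The Poincaré bound for `L¹ ⋆ C_c` -/

/-- **The Poincaré bound for `f₁ ⋆ f₂` with `f₁ ∈ L¹` and `f₂ ∈ C_c`**, uniform in `x ∈ G` and `y` in a compact `C₂`:
the family `γ ↦ ‖(f₁ ⋆ f₂)(x⁻¹ γ y)‖` over the rational points is summable with sum `≤ ‖f₁‖₁ · M`.  For every finite `F`,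
`∑_{γ ∈ F} ‖(f₁ ⋆ f₂)(x⁻¹ γ y)‖ ≤ ∫ ‖f₁(h)‖ · ∑_{γ ∈ F} ‖f₂(h⁻¹ x⁻¹ γ y)‖ dh ≤ ‖f₁‖₁ · M`, the inner sum being the
lattice sum at the one-sided translate `g = x h`; summability and the `tsum` bound follow from the bounded partial sums
(`summable_of_sum_le`, `Real.tsum_le_of_sum_le`). -/
theorem exists_summable_norm_conv_of_isTestL1 {f₁ f₂ : G → ℂ} (h₁ : Common.IsTestL1 S f₁) (h₂ : IsTest f₂)
    {C₂ : Set G} (hC₂ : IsCompact C₂) :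
    ∃ M : ℝ, ∀ x : G, ∀ y ∈ C₂, Summable (fun γ : S.Gk => ‖S.conv f₁ f₂ (x⁻¹ * γ * y)‖) ∧
      ∑' γ : S.Gk, ‖S.conv f₁ f₂ (x⁻¹ * γ * y)‖ ≤ M := by
  obtain ⟨M, -, hM⟩ := exists_sum_norm_le_of_isTest S h₂ hC₂
  obtain ⟨B, hB⟩ : ∃ B : ℝ, ∀ z, ‖f₂ z‖ ≤ B := by
    obtain ⟨B, hB⟩ := h₂.cont.norm.bddAbove_range_of_hasCompactSupport h₂.compact.norm
    exact ⟨B, fun z => hB ⟨z, rfl⟩⟩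
  refine ⟨(∫ h, ‖f₁ h‖ ∂S.μ) * M, fun x y hy => ?_⟩
  have hbound : ∀ F : Finset S.Gk,
      ∑ γ ∈ F, ‖S.conv f₁ f₂ (x⁻¹ * γ * y)‖ ≤ (∫ h, ‖f₁ h‖ ∂S.μ) * M := by
    intro F
    -- each term of the finite sum is an integrable function of `h`
    have hint : ∀ γ : S.Gk, Integrable (fun h => ‖f₁ h‖ * ‖f₂ (h⁻¹ * (x⁻¹ * γ * y))‖) S.μ := by
      intro γ
      refine h₁.2.norm.mul_bdd (c := B) ?_ (Eventually.of_forall fun h => ?_)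
      · exact (h₂.cont.norm.comp (continuous_inv.mul continuous_const)).aestronglyMeasurable
      · rw [norm_norm]
        exact hB _
    have heq : ∀ h : G, ∀ γ : S.Gk, h⁻¹ * (x⁻¹ * γ * y) = (x * h)⁻¹ * γ * y := fun h γ => by group
    calc ∑ γ ∈ F, ‖S.conv f₁ f₂ (x⁻¹ * γ * y)‖
        ≤ ∑ γ ∈ F, ∫ h, ‖f₁ h‖ * ‖f₂ (h⁻¹ * (x⁻¹ * γ * y))‖ ∂S.μ := by
          apply Finset.sum_le_sum
          intro γ _
          unfold Setting.conv
          refine (norm_integral_le_integral_norm _).trans (le_of_eq ?_)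
          congr 1
          funext h
          rw [norm_mul]
      _ = ∫ h, ∑ γ ∈ F, ‖f₁ h‖ * ‖f₂ (h⁻¹ * (x⁻¹ * γ * y))‖ ∂S.μ :=
          (integral_finsetSum F fun γ _ => hint γ).symm
      _ = ∫ h, ‖f₁ h‖ * ∑ γ ∈ F, ‖f₂ (h⁻¹ * (x⁻¹ * γ * y))‖ ∂S.μ := by
          congr 1
          funext h
          rw [Finset.mul_sum]
      _ ≤ ∫ h, ‖f₁ h‖ * M ∂S.μ := by
          apply integral_mono_of_nonneg
          · exact Eventually.of_forall fun h =>
              mul_nonneg (norm_nonneg _) (Finset.sum_nonneg fun γ _ => norm_nonneg _)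
          · exact h₁.2.norm.mul_const M
          · refine Eventually.of_forall fun h => ?_
            apply mul_le_mul_of_nonneg_left _ (norm_nonneg _)
            simp only [heq]
            exact hM (x * h) y hy F
      _ = (∫ h, ‖f₁ h‖ ∂S.μ) * M := integral_mul_const _ _
  exact ⟨summable_of_sum_le (fun γ => norm_nonneg _) hbound,
    Real.tsum_le_of_sum_le (fun γ => norm_nonneg _) hbound⟩

/-- **The (α)-form Poincaré display of S14790 as a theorem**: for `f₁ ∈ L¹`, `f₂ ∈ C_c` and compacts `C₁, C₂`, one bound
`M` with `∑_γ ‖(f₁ ⋆ f₂)(x⁻¹ γ y)‖ ≤ M` (summable, non-negative family) for all `x ∈ C₁`, `y ∈ C₂`. -/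
theorem poincareUniform_conv_of_isTestL1 {f₁ f₂ : G → ℂ} (h₁ : Common.IsTestL1 S f₁) (h₂ : IsTest f₂) :
    ∀ C₁ C₂ : Set G, IsCompact C₁ → IsCompact C₂ → ∃ M : ℝ, ∀ x ∈ C₁, ∀ y ∈ C₂,
      Summable (fun γ : S.Gk => ‖S.conv f₁ f₂ (x⁻¹ * γ * y)‖) ∧
        ∑' γ : S.Gk, ‖S.conv f₁ f₂ (x⁻¹ * γ * y)‖ ≤ M := by
  intro C₁ C₂ _ hC₂
  obtain ⟨M, hM⟩ := exists_summable_norm_conv_of_isTestL1 S h₁ h₂ hC₂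
  exact ⟨M, fun x _ y hy => hM x y hy⟩

/-- The kernel `K_{f₁ ⋆ f₂}(x, y) = ∑_γ (f₁ ⋆ f₂)(x⁻¹ γ y)` converges absolutely at every point, for `f₁ ∈ L¹` and
`f₂ ∈ C_c`. -/
theorem summable_norm_conv_of_isTestL1 {f₁ f₂ : G → ℂ} (h₁ : Common.IsTestL1 S f₁) (h₂ : IsTest f₂) (x y : G) :
    Summable (fun γ : S.Gk => ‖S.conv f₁ f₂ (x⁻¹ * γ * y)‖) := by
  obtain ⟨M, hM⟩ := exists_summable_norm_conv_of_isTestL1 S h₁ h₂ (isCompact_singleton (x := y))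
  exact (hM x y (Set.mem_singleton y)).1

end Summit.Ventures.HodgeRepro.Tier4.Line4

end
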